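import Summits.CriticalPhenomena.Ising3DConformalLimit.Theses.LogPolarProxy

/-!
# `LogPolarProxy.Assembly` (stmt-CriticalPhenomena-4588) — proved (pure logic)

Route `route-CriticalPhenomena-LogPolarProxy`, sub-problem `Ising3DConformalLimit`, assembly item (rank 1):
`ExistsContinuousLimit → ProxyUniversality → ProxyInversionTransfer → MoebiusFromTranslationsAndInversion →
IsingEuclidUpgradeR4NonGaussian → Ising3DConformalLimit`.

Proof: this is the route's deciding theorem `LogPolarProxy.closes` (planner-authored, D-0027 §2.1) read as an
implication — take `(ρ, Δ, S)` from `ExistsContinuousLimit`; `ProxyUniversality` gives the proxy convergence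
for `(ρ, S)`; `ProxyInversionTransfer` turns it into `IsInversionCovariant Δ S`;
`MoebiusFromTranslationsAndInversion` (with the translation and scale clauses) gives `IsMoebiusCovariant Δ S`;
`IsingEuclidUpgradeR4NonGaussian` gives `HasNontrivialU4 S`; these are the clauses of the sub-problem
statement. No mathematics beyond the bookkeeping; the open content of the route lives in its three cruxes.

Sources: H. Duminil-Copin, *100 years of the (critical) Ising model on the hypercubic lattice*, ICM 2022
[DuminilCopinICM2022]; P. Di Francesco, P. Mathieu, D. Sénéchal, *Conformal Field Theory* (Springer 1997)
§4.1 [FrancescoMathieuSenechal1997].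
-/

namespace Summit.CriticalPhenomena.Ising3DConformalLimit.LogPolarProxyAssembly

open Summit.CriticalPhenomena.Ising3DConformalLimit.Theses.LogPolarProxy

/-- **`Assembly` holds** (item stmt-CriticalPhenomena-4588): the five route items imply the sub-problem
statement `Ising3DConformalLimit` — the argument of the route's deciding theorem `closes`, as a term of
the item's exact signature. [folklore] -/
theorem logPolarProxy_assembly_proof :
    Summit.CriticalPhenomena.Ising3DConformalLimit.Theses.LogPolarProxy.Assembly := by
  unfold Assembly
  intro hE hUH hT hM hNG
  -- (E_c): the continuous, non-degenerate, translation-invariant, scale-covariant limit (ρ, Δ, S)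
  obtain ⟨ρ, Δ, S, hρ, hΔ, hlim, hzero, hcont, hnd, htr, hsc⟩ := hE
  -- (UH): proxy convergence for (ρ, S); transfer ⇒ inversion covariance; group lemma ⇒ Möbius
  have hprox := hUH ρ S hρ hlim hnd
  have hinv : Literature.Probability.LatticeModels.IsInversionCovariant Δ S :=
    hT ρ Δ S hρ hlim hzero hcont hnd hsc hprox
  have hmoeb : Literature.Probability.LatticeModels.IsMoebiusCovariant Δ S :=
    hM Δ S hΔ hzero hcont htr hsc hinv
  -- (N4): non-Gaussianity
  have hU4 : Literature.Probability.LatticeModels.HasNontrivialU4 S := hNG ρ S hρ hlim hnd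
  exact ⟨ρ, Δ, S, hρ, hΔ, hlim, hnd, hmoeb, hU4⟩

end Summit.CriticalPhenomena.Ising3DConformalLimit.LogPolarProxyAssembly
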